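import Mathlib
import Literature.RepresentationTheory.FiniteGroups.KLRGradedCellularBasis

/-!
# `SnSubsetDichotomy.NoThresholdSubsetTriple`, line `klr-graded-polynomial-method`:
# stub `pairDeviation_of_moments` (bridge K: uniform moments → two-sided deviation)

The Markov bridge from the uniform-MOMENT form of the open stub J′ of crux
stmt-MatrixMultiplication-8302 to its two-sided DEVIATION form. Index the same-shape pairs
`(μ, S, T)` of standard tableaux by `TableauPair n` and put `Z i = X i − w i`, where
`X i = TableauPair.degree 2 i = deg₂ S + deg₂ T` and `w i = c₀ − (c₀ − c₁)²` is the `2`-weight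
of the shape (`cⱼ = TableauPair.content 2 i j`). If for some `C > 0`, all large `n` and all
orders `1 ≤ k`, `k² ≤ n` the even moments grow sub-Gaussianly on the scale `n^{3/4}`,
`∑ᵢ (Z i)^{2k} ≤ n! · (C k)^k · √n^{3k}`, then for some `c > 0` and all large `n` the two-sided
deviation count `#{i : n ≤ 100·|Z i|}` is at most `n! · e^{-c√n}`.

Proof: Markov's inequality at the even order `2k` with the choice `k = ⌊√n / D⌋`,
`D = 30000 · max C 1` (so `1 ≤ k`, `k² ≤ n`). On the bad set `n^{2k} ≤ 100^{2k} (Z i)^{2k}`,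
so summing and enlarging to the full (termwise nonnegative) sum,
`#Bad · √n^{4k} ≤ 100^{2k} · n! · (C k)^k · √n^{3k}`, i.e. `#Bad ≤ n! · (10⁴ C k / √n)^k`, and
`10⁴ C k / √n ≤ 10⁴ C / D ≤ 1/3`; finally `(1/3)^k ≤ e^{-k} ≤ e^{1 - √n/D} ≤ e^{-√n/(2D)}` once
`√n ≥ 2D`, giving `c = 1/(2D)`. The statement never uses the meaning of `Z`: it is proved for an
arbitrary family of integer-valued functions on finite types
(`PairDeviationOfMoments.deviation_of_moments`) and then specialised.
-/

namespace Summit.MatrixMultiplication.MatrixMultiplication.Theorems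

open Literature.RepresentationTheory.FiniteGroups (TableauPair KLRGradedCellularBasis residueContent tableauDegree)
open scoped BigOperators

namespace PairDeviationOfMoments

/-- **Markov's inequality at an even order on a finite type.** For `Z : α → ℤ` and `n k : ℕ`,
`#{i : n ≤ 100·|Z i|} · n^{2k} ≤ 100^{2k} · ∑ᵢ (Z i)^{2k}`: on the bad set
`n^{2k} ≤ (100 |Z i|)^{2k} = 100^{2k} (Z i)^{2k}`, and the remaining terms are nonnegative. -/
private theorem card_mul_pow_le {α : Type*} [Fintype α] (Z : α → ℤ) (n k : ℕ) :
    (Nat.card {i : α // (n : ℤ) ≤ 100 * |Z i|} : ℝ) * (n : ℝ) ^ (2 * k) ≤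
      100 ^ (2 * k) * ∑ i : α, ((Z i : ℤ) : ℝ) ^ (2 * k) := by
  have hk : Even (2 * k) := even_two_mul k
  rw [Nat.card_eq_fintype_card, Fintype.card_subtype, Finset.mul_sum]
  calc ((Finset.univ.filter fun i : α => (n : ℤ) ≤ 100 * |Z i|).card : ℝ) * (n : ℝ) ^ (2 * k)
        = ∑ _i ∈ Finset.univ.filter (fun i : α => (n : ℤ) ≤ 100 * |Z i|), (n : ℝ) ^ (2 * k) := by
        rw [Finset.sum_const, nsmul_eq_mul]
    _ ≤ ∑ i ∈ Finset.univ.filter (fun i : α => (n : ℤ) ≤ 100 * |Z i|),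
          (100 : ℝ) ^ (2 * k) * ((Z i : ℤ) : ℝ) ^ (2 * k) := by
        refine Finset.sum_le_sum fun i hi => ?_
        have hi' : (n : ℤ) ≤ 100 * |Z i| := (Finset.mem_filter.mp hi).2
        have hR : (n : ℝ) ≤ 100 * |((Z i : ℤ) : ℝ)| := by exact_mod_cast hi'
        calc (n : ℝ) ^ (2 * k) ≤ (100 * |((Z i : ℤ) : ℝ)|) ^ (2 * k) :=
              pow_le_pow_left₀ (Nat.cast_nonneg n) hR _
          _ = 100 ^ (2 * k) * ((Z i : ℤ) : ℝ) ^ (2 * k) := by rw [mul_pow, hk.pow_abs]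
    _ ≤ ∑ i, (100 : ℝ) ^ (2 * k) * ((Z i : ℤ) : ℝ) ^ (2 * k) :=
        Finset.sum_le_sum_of_subset_of_nonneg (Finset.subset_univ _) fun i _ _ =>
          mul_nonneg (pow_nonneg (by norm_num) _) (hk.pow_nonneg _)

/-- `1/3 ≤ e^{-1}`, i.e. `e ≤ 3`, from the nine-digit bound `Real.exp_one_lt_d9`. -/
private theorem one_third_le_exp_neg_one : (1 / 3 : ℝ) ≤ Real.exp (-1) := by
  rw [Real.exp_neg, ← one_div]
  exact one_div_le_one_div_of_le (Real.exp_pos 1) (le_trans Real.exp_one_lt_d9.le (by norm_num))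

/-- **Moments → deviation, abstract form.** For a family of finite types `α n` and integer
functions `Z n : α n → ℤ`: if `∑ᵢ (Z n i)^{2k} ≤ n!·(C k)^k·√n^{3k}` for all large `n` and all
`1 ≤ k`, `k² ≤ n`, then `#{i : n ≤ 100·|Z n i|} ≤ n!·e^{-c√n}` for some `c > 0` and all large
`n` (Markov at order `2k` with `k = ⌊√n/D⌋`, `D = 30000·max C 1`, `c = 1/(2D)`). -/
private theorem deviation_of_moments {α : ℕ → Type*} [∀ n, Fintype (α n)] (Z : ∀ n, α n → ℤ)
    (h : ∃ C : ℝ, 0 < C ∧ ∃ n₀ : ℕ, ∀ n ≥ n₀, ∀ k : ℕ, 1 ≤ k → k ^ 2 ≤ n →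
      ∑ i : α n, ((Z n i : ℤ) : ℝ) ^ (2 * k) ≤
        (n.factorial : ℝ) * (C * k) ^ k * Real.sqrt (n : ℝ) ^ (3 * k)) :
    ∃ c : ℝ, 0 < c ∧ ∃ n₀ : ℕ, ∀ n ≥ n₀,
      (Nat.card {i : α n // (n : ℤ) ≤ 100 * |Z n i|} : ℝ) ≤
        (n.factorial : ℝ) * Real.exp (-(c * Real.sqrt (n : ℝ))) := by
  obtain ⟨C, hC, n₀, hmom⟩ := h
  -- the constant `D = 30000 · max C 1`; only `30000 ≤ D` and `10000 C ≤ D / 3` are used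
  obtain ⟨D, hD1, hCD⟩ : ∃ D : ℝ, 30000 ≤ D ∧ 10000 * C ≤ D / 3 :=
    ⟨30000 * max C 1, by linarith [le_max_right C 1], by linarith [le_max_left C 1]⟩
  have hDpos : 0 < D := by linarith
  refine ⟨1 / (2 * D), by positivity, max n₀ (⌈2 * D⌉₊ ^ 2), fun n hn => ?_⟩
  have hn₀ : n₀ ≤ n := le_trans (le_max_left _ _) hn
  -- `x = √n ≥ 2D`
  obtain ⟨x, hxdef⟩ : ∃ x : ℝ, Real.sqrt n = x := ⟨_, rfl⟩
  have hx2D : 2 * D ≤ x := by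
    have h1 : ((⌈2 * D⌉₊ ^ 2 : ℕ) : ℝ) ≤ n := by exact_mod_cast le_trans (le_max_right _ _) hn
    calc 2 * D ≤ ⌈2 * D⌉₊ := Nat.le_ceil _
      _ = Real.sqrt (((⌈2 * D⌉₊ ^ 2 : ℕ) : ℝ)) := by
          rw [Nat.cast_pow, Real.sqrt_sq (Nat.cast_nonneg _)]
      _ ≤ x := hxdef ▸ Real.sqrt_le_sqrt h1
  have hxpos : 0 < x := by linarith
  have hxsq : x ^ 2 = n := hxdef ▸ Real.sq_sqrt (Nat.cast_nonneg n)
  -- the order `k = ⌊x / D⌋`: `1 ≤ k`, `k² ≤ n`, `x / D - 1 < k ≤ x / D`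
  obtain ⟨k, hkdef⟩ : ∃ k : ℕ, ⌊x / D⌋₊ = k := ⟨_, rfl⟩
  have hk_le : (k : ℝ) ≤ x / D := hkdef ▸ Nat.floor_le (div_nonneg hxpos.le hDpos.le)
  have hk_gt : x / D < k + 1 := hkdef ▸ Nat.lt_floor_add_one (x / D)
  have hxD : 2 ≤ x / D := by rw [le_div_iff₀ hDpos]; linarith
  have hk1 : 1 ≤ k := by
    have : (1 : ℝ) < k := by linarith
    exact_mod_cast this.le
  have hkx : (k : ℝ) ≤ x := le_trans hk_le (div_le_self hxpos.le (by linarith))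
  have hk2 : k ^ 2 ≤ n := by
    have : ((k ^ 2 : ℕ) : ℝ) ≤ n := by
      rw [Nat.cast_pow, ← hxsq]
      exact pow_le_pow_left₀ (Nat.cast_nonneg k) hkx 2
    exact_mod_cast this
  -- Markov at order `2k` and the moment bound: `#Bad · x^{4k} ≤ n! · (1/3)^k · x^{4k}`
  have hM := hmom n hn₀ k hk1 hk2
  rw [hxdef] at hM
  have hkey : 10000 * C * k ≤ x / 3 := by
    calc 10000 * C * k ≤ 10000 * C * (x / D) := by gcongr
      _ = 10000 * C / D * x := by ring
      _ ≤ D / 3 / D * x := by gcongr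
      _ = x / 3 := by field_simp
  have h100 : (100 : ℝ) ^ (2 * k) = 10000 ^ k := by rw [pow_mul]; norm_num
  have hB : (Nat.card {i : α n // (n : ℤ) ≤ 100 * |Z n i|} : ℝ) * x ^ (4 * k) ≤
      (n.factorial : ℝ) * (1 / 3) ^ k * x ^ (4 * k) := by
    calc (Nat.card {i : α n // (n : ℤ) ≤ 100 * |Z n i|} : ℝ) * x ^ (4 * k)
          = (Nat.card {i : α n // (n : ℤ) ≤ 100 * |Z n i|} : ℝ) * (n : ℝ) ^ (2 * k) := by
          rw [← hxsq]; ring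
      _ ≤ 100 ^ (2 * k) * ∑ i : α n, ((Z n i : ℤ) : ℝ) ^ (2 * k) := card_mul_pow_le (Z n) n k
      _ ≤ 100 ^ (2 * k) * ((n.factorial : ℝ) * (C * k) ^ k * x ^ (3 * k)) := by gcongr
      _ = (n.factorial : ℝ) * ((10000 * C * k) ^ k * x ^ (3 * k)) := by
          rw [h100, mul_pow, mul_pow, mul_pow]; ring
      _ ≤ (n.factorial : ℝ) * ((x / 3) ^ k * x ^ (3 * k)) := by gcongr
      _ = (n.factorial : ℝ) * (1 / 3) ^ k * x ^ (4 * k) := by ring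
  have hcard : (Nat.card {i : α n // (n : ℤ) ≤ 100 * |Z n i|} : ℝ) ≤
      (n.factorial : ℝ) * (1 / 3) ^ k :=
    le_of_mul_le_mul_right hB (pow_pos hxpos _)
  -- `(1/3)^k ≤ e^{-k} ≤ e^{-x/(2D)}`
  rw [hxdef]
  refine hcard.trans (mul_le_mul_of_nonneg_left ?_ (Nat.cast_nonneg _))
  calc (1 / 3 : ℝ) ^ k ≤ Real.exp (-1) ^ k :=
        pow_le_pow_left₀ (by norm_num) one_third_le_exp_neg_one k
    _ = Real.exp (k * (-1)) := (Real.exp_nat_mul (-1) k).symm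
    _ ≤ Real.exp (-(1 / (2 * D) * x)) := by
        rw [Real.exp_le_exp]
        have : 1 / (2 * D) * x = x / D / 2 := by ring
        rw [this]
        linarith

end PairDeviationOfMoments

set_option linter.dupNamespace false in -- deliberate Summit.<S>.<P> duplicate
open PairDeviationOfMoments in
/-- **Stub `pairDeviation_of_moments` (bridge K of line `klr-graded-polynomial-method`, crux
`SnSubsetDichotomy.NoThresholdSubsetTriple`, stmt-MatrixMultiplication-8302).** With
`Z i = X i − w i` on `TableauPair n` (`X i = TableauPair.degree 2 i = deg₂ S + deg₂ T`,
`w i = c₀ − (c₀ − c₁)²`, `cⱼ = TableauPair.content 2 i j`): if the even moments of `Z` grow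
sub-Gaussianly on the scale `n^{3/4}` uniformly up to order `√n`,
`∑ᵢ (Z i)^{2k} ≤ n!·(C k)^k·√n^{3k}` for all large `n` and all `1 ≤ k`, `k² ≤ n`, then the
two-sided deviation count `#{i : n ≤ 100·|Z i|}` is at most `n!·e^{-c√n}` for some `c > 0` and
all large `n`. Markov's inequality at order `2k`, `k = ⌊√n / D⌋`
(`PairDeviationOfMoments.deviation_of_moments`). -/
theorem pairDeviation_of_moments : (∃ C : ℝ, 0 < C ∧ ∃ n₀ : ℕ, ∀ n ≥ n₀, ∀ k : ℕ, 1 ≤ k → k ^ 2 ≤ n → ∑ i : TableauPair n, ((TableauPair.degree 2 i - ((TableauPair.content 2 i 0 : ℤ) - ((TableauPair.content 2 i 0 : ℤ) - (TableauPair.content 2 i 1 : ℤ)) ^ 2) : ℤ) : ℝ) ^ (2 * k) ≤ (n.factorial : ℝ) * (C * k) ^ k * Real.sqrt (n : ℝ) ^ (3 * k)) → (∃ c : ℝ, 0 < c ∧ ∃ n₀ : ℕ, ∀ n ≥ n₀, (Nat.card {i : TableauPair n // (n : ℤ) ≤ 100 * |TableauPair.degree 2 i - ((TableauPair.content 2 i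 0 : ℤ) - ((TableauPair.content 2 i 0 : ℤ) - (TableauPair.content 2 i 1 : ℤ)) ^ 2)|} : ℝ) ≤ (n.factorial : ℝ) * Real.exp (-(c * Real.sqrt (n : ℝ)))) :=
  fun h => deviation_of_moments (α := TableauPair)
    (fun _ i => TableauPair.degree 2 i - ((TableauPair.content 2 i 0 : ℤ) -
      ((TableauPair.content 2 i 0 : ℤ) - (TableauPair.content 2 i 1 : ℤ)) ^ 2)) h

end Summit.MatrixMultiplication.MatrixMultiplication.Theorems
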